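/-
Copyright (c) 2026 the pub-hodgecm-mathlib formalisation cell (harness21).  Prover seat hodgecm-mathlib-LH7-p02 (g6): LH4-plan (g6) WORD #99 price-list item (P8b)
«T5-u AT EVERY NON-SPLIT PLACE», sequel — the de-`h2` twin of ★ `FinExplicitTransferFactorDeepTauTamePairs` (F0P3a-p04 (g16)); LH5-p01 (g5) census
`CENSUS-DRAM-h2.v1` 3989fe6bdd514291 §1 M4 ∕ §3 (d3), flag (F4); 2026-09-02.
-/
import Literature.NumberTheory.Rogawski1990.FinExplicitTransferFactorDeepTauAnyPlace   -- (P8b) part I: the any-place τ-head `exists_forall_finTau_eq_hilbertSymbol_of_deep_anyPlace`, `exists_valued_two_eq_valued_toPlace_heckeUniformizer_pow`, `valued_two_le_one`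
import HarnessLib

/-!
# `Δ‴_v(γ_H, γ′) = (β(γ_H), θ)_v · q_v^{−m} · κ_v(γ_H, γ′)` on matched deep pairs at EVERY non-split place (dyadic included); germ form; the `|2|`-carrying depth token
# ([Rogawski1990] §4.9 p. 55, Lemma 4.9.3 p. 56, Prop. 8.1.3 p. 116; [LabesseLanglands1979] §2; [NeukirchANT1999] Ch. I §8, Ch. II §6)

Topic `NumberTheory/Rogawski1990`; namespace `Literature.NumberTheory.Rogawski1990`.  THEOREMS ONLY (no definition, no instance, no notation, no named fact, no `sorry`);
kernel lane `--supports stmt-HodgeConjecture-24833`.  Cell `pub/hodgecm-mathlib` (D-0151), crux H413 = `stmt-HodgeConjecture-24833`; half A line LH4 (dyadic pay-down),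
LH4-plan (g6) WORD #99 price list, item **(P8b)**, sequel of `FinExplicitTransferFactorDeepTauAnyPlace` (the τ-head at any place): here the `D`-half and the assembled
factor, i.e. ★ `FinExplicitTransferFactorDeepTauTamePairs` with its binder `h2 : |2|_w = 1` DELETED.  ROAD-INDEPENDENT.  HONEST LABEL: HC_CM is proved only modulo the
7 printed citations (2 remaining named inputs: hLiu418 = stmt-HodgeConjecture-24832, h413 = stmt-HodgeConjecture-24833) until rung 0 closes; this file is count-neutral
((D-RAM)∕(D-UNR) stay PRINT; pays no organ, opens no road).

* §3 **the depth token at any place** `valued_eval_eq_valued_toPlace_pow_toNat_of_toPlace_eq_of_valued_le_two_mul`: for `|2|`-deep `γ_H` (`|u_w − 1|_w, |det g_w − 1|_w ≤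
  |2|_w·|ι_w ϖ_v|_w^{M₀}`) the token `u_w² + det g_w = 2 + ((u_w − 1)(u_w + 1) + (det g_w − 1))` has valuation EXACTLY `|2|_w` (census flag (F4): «depth tokens acquire
  `|2|_w`»), which cancels the `2` of the symmetrised discriminant's denominator, so still `|χ_g(u)_w|_w = |ι_w β|_w = |ι_w ϖ_v|_w^{ord_v β}`.
* §4 **`exists_forall_finExplicitDelta_eq_hilbertSymbol_mul_of_deep_anyPlace`** (`Δ‴_v = (β, θ)_v·q_v^{−m}·κ_v` on matched deep pairs; ★ :104 minus `h2`), its germ form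
  `exists_nhds_one_forall_finExplicitDelta_eq_hilbertSymbol_mul_anyPlace` (★ :239 minus `h2`), and the scalar pull-outs
  `exists_nhds_one_forall_finsum_Δ_mul_eq_hilbertSymbol_mul_anyPlace` ∕ `…_toNat_anyPlace` (★ :293 ∕ :328 minus `h2`; the `toNat` one takes its neighbourhood at level
  `1 + ord_v 2`).
The TAME heads (★, `h2`) are the specialisations `|2|_w = 1` and are NOT restated.

## References
* [Rogawski1990] J. D. Rogawski, *Automorphic Representations of Unitary Groups in Three Variables* (1990): §4.9 p. 55, §4.3 (4.3.1) p. 43, Prop. 8.1.3 p. 116.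
* [LabesseLanglands1979] J.-P. Labesse, R. P. Langlands, *L-indistinguishability for SL(2)*, Canad. J. Math. 31 (1979): §2, (2.1)–(2.2).
* [NeukirchANT1999] J. Neukirch, *Algebraic Number Theory* (1999): Ch. I §8 Prop. 8.2 (`e f g = n`), Ch. II §6 (`‖·‖_w = (N𝔓_w)^{−ord_w}`).
-/

set_option autoImplicit false

noncomputable section

open NumberField IsDedekindDomain Filter Topology Matrix

namespace Literature.NumberTheory.Rogawski1990

open Literature.NumberTheory.Automorphic Literature.NumberTheory.Automorphic.UnitaryGroup Literature.NumberTheory.GaloisRepresentations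
open Literature.NumberTheory.QuadraticForms

variable (L : Type) [Field L] [NumberField L] [IsCMField L] (v : HeightOneSpectrum (𝓞 ↥(maximalRealSubfield L)))
  (w : PlacesOver L v) (hw : IsCMField.complexConj L • w.1 = w.1)

/-! ## §3 THE DEPTH TOKEN IN `β`-CURRENCY AT ANY PLACE: `u_w² + det g_w` has valuation EXACTLY `|2|_w` for `|2|`-deep `γ_H` (census flag (F4)) -/

section Depth

/-- **THE DEPTH TOKEN EXISTS AT ANY NON-SPLIT PLACE, IN `β`-CURRENCY** (★ `valued_eval_eq_valued_toPlace_pow_toNat_of_toPlace_eq` with `h2 ↦` the `|2|`-deeper binders): if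
`γ_H = (g, u)` has `|u_w − 1|_w, |det g_w − 1|_w ≤ |2|_w·|ι_w ϖ_v|_w^{M₀}` (`M₀ ≥ 1`), `|χ_g(u)_w|_w ≤ 1`, and `ι_w β = −χ_g(u)_w·(u_w² + det g_w)∕(2·u_w²·det g_w)` with
`β ∈ L⁺_vˣ`, then **`|χ_g(u)_w|_w = |ι_w ϖ_v|_w^m` with `m := (−log|β|_v).toNat = ord_v β`** — because `u_w² + det g_w = 2 + ((u_w − 1)(u_w + 1) + (det g_w − 1)) ∈ 2 + 2𝔪_w`
has valuation EXACTLY `|2|_w` (census flag (F4): the token `u² + d` «acquires `|2|_w`»), which cancels the `2` of the denominator: `|ι_w β|_w = |χ_g(u)_w|_w`.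
[cite: Rogawski1990, §4.9 p. 55] [cite: NeukirchANT1999, Ch. II §6] -/
theorem valued_eval_eq_valued_toPlace_pow_toNat_of_toPlace_eq_of_valued_le_two_mul {M₀ : ℕ} (hM₁ : 1 ≤ M₀)
    (γH : (cmDatum L 2 (Matrix.of fun i j : Fin 2 => if i.val + j.val + 1 = 2 then (1 : L) else 0)).Local v ×
      (cmDatum L 1 (Matrix.of fun i j : Fin 1 => if i.val + j.val + 1 = 1 then (1 : L) else 0)).Local v)
    (hud : Valued.v (finGammaTwo L v γH w - 1) ≤ Valued.v (2 : w.1.adicCompletion L) *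
      Valued.v ((toPlace v w (HeckeCharacter.uniformizer ↥(maximalRealSubfield L) v : v.adicCompletion ↥(maximalRealSubfield L))) ^ M₀))
    (hdd : Valued.v (((γH.1.val.val : Matrix (Fin 2) (Fin 2) (LocalRing L v)).map
        (Pi.evalRingHom (fun w' : PlacesOver L v => w'.1.adicCompletion L) w)).det - 1) ≤ Valued.v (2 : w.1.adicCompletion L) *
      Valued.v ((toPlace v w (HeckeCharacter.uniformizer ↥(maximalRealSubfield L) v : v.adicCompletion ↥(maximalRealSubfield L))) ^ M₀))
    (hχ1 : Valued.v (((finCharpolyTwo L v γH).eval (finGammaTwo L v γH)) w) ≤ 1)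
    (β : (v.adicCompletion ↥(maximalRealSubfield L))ˣ)
    (hβ : toPlace v w (β : v.adicCompletion ↥(maximalRealSubfield L)) =
      -(((finCharpolyTwo L v γH).eval (finGammaTwo L v γH)) w *
          (finGammaTwo L v γH w ^ 2 +
            ((γH.1.val.val : Matrix (Fin 2) (Fin 2) (LocalRing L v)).map (Pi.evalRingHom (fun w' : PlacesOver L v => w'.1.adicCompletion L) w)).det)) /
        (2 * finGammaTwo L v γH w ^ 2 *
          ((γH.1.val.val : Matrix (Fin 2) (Fin 2) (LocalRing L v)).map (Pi.evalRingHom (fun w' : PlacesOver L v => w'.1.adicCompletion L) w)).det)) :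
    Valued.v (((finCharpolyTwo L v γH).eval (finGammaTwo L v γH)) w) =
      Valued.v ((toPlace v w (HeckeCharacter.uniformizer ↥(maximalRealSubfield L) v : v.adicCompletion ↥(maximalRealSubfield L))) ^
        (-WithZero.log (Valued.v (β : v.adicCompletion ↥(maximalRealSubfield L)))).toNat) := by
  classical
  haveI := PlacesOver.liesOver w
  set ϖ : w.1.adicCompletion L := toPlace v w (HeckeCharacter.uniformizer ↥(maximalRealSubfield L) v : v.adicCompletion ↥(maximalRealSubfield L)) with hϖdef
  set u := finGammaTwo L v γH w with hudef
  set χw := ((finCharpolyTwo L v γH).eval (finGammaTwo L v γH)) w with hχwdef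
  set d := ((γH.1.val.val : Matrix (Fin 2) (Fin 2) (LocalRing L v)).map (Pi.evalRingHom (fun w' : PlacesOver L v => w'.1.adicCompletion L) w)).det with hddef
  have hϖM1 : Valued.v (ϖ ^ M₀) < 1 := valued_toPlace_heckeUniformizer_pow_lt_one L v w hM₁
  have h20 : (2 : w.1.adicCompletion L) ≠ 0 := two_ne_zero_adicCompletion L v w
  have hv20 : Valued.v (2 : w.1.adicCompletion L) ≠ 0 := (Valuation.ne_zero_iff _).2 h20
  have hv2 : 0 < Valued.v (2 : w.1.adicCompletion L) := zero_lt_iff.2 hv20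
  have h2le : Valued.v (2 : w.1.adicCompletion L) ≤ 1 := valued_two_le_one L v w
  have h2M : Valued.v (2 : w.1.adicCompletion L) * Valued.v (ϖ ^ M₀) < Valued.v (2 : w.1.adicCompletion L) := by
    have h := mul_lt_mul_of_pos_left hϖM1 hv2
    rwa [mul_one] at h
  -- `u`, `d` are units; `u² + d` has valuation `|2|`
  have hu1 : Valued.v (u - 1) < 1 := lt_of_le_of_lt (le_trans hud (mul_le_of_le_one_left' h2le)) hϖM1
  have hd1 : Valued.v (d - 1) < 1 := lt_of_le_of_lt (le_trans hdd (mul_le_of_le_one_left' h2le)) hϖM1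
  have hvu : Valued.v u = 1 := by
    have h := Valuation.map_one_add_of_lt (Valued.v : Valuation (w.1.adicCompletion L) _) hu1
    rwa [add_sub_cancel] at h
  have hvd : Valued.v d = 1 := by
    have h := Valuation.map_one_add_of_lt (Valued.v : Valuation (w.1.adicCompletion L) _) hd1
    rwa [add_sub_cancel] at h
  have hu0 : u ≠ 0 := fun h0 => by rw [h0, map_zero] at hvu; exact zero_ne_one hvu
  have hd0 : d ≠ 0 := fun h0 => by rw [h0, map_zero] at hvd; exact zero_ne_one hvd
  have hs : Valued.v (u ^ 2 + d) = Valued.v (2 : w.1.adicCompletion L) := by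
    have hlt : Valued.v ((u - 1) * (u + 1) + (d - 1)) < Valued.v (2 : w.1.adicCompletion L) := by
      refine lt_of_le_of_lt (Valuation.map_add _ _ _) (max_lt ?_ (lt_of_le_of_lt hdd h2M))
      rw [Valuation.map_mul]
      calc Valued.v (u - 1) * Valued.v (u + 1) ≤ (Valued.v (2 : w.1.adicCompletion L) * Valued.v (ϖ ^ M₀)) * 1 := by
            gcongr
            exact le_trans (Valuation.map_add _ _ _) (max_le hvu.le (le_of_eq (Valuation.map_one _)))
        _ < Valued.v (2 : w.1.adicCompletion L) := by rw [mul_one]; exact h2M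
    have h := Valuation.map_add_eq_of_lt_left (Valued.v : Valuation (w.1.adicCompletion L) _) hlt
    rw [show (2 : w.1.adicCompletion L) + ((u - 1) * (u + 1) + (d - 1)) = u ^ 2 + d by ring] at h
    exact h
  have hs0 : u ^ 2 + d ≠ 0 := fun h0 => by rw [h0, map_zero] at hs; exact hv20 hs.symm
  -- `|χ_w| = |ι β|`
  have hχβ : Valued.v χw = Valued.v (toPlace v w (β : v.adicCompletion ↥(maximalRealSubfield L))) := by
    rw [hβ, Valuation.map_div, Valuation.map_neg, Valuation.map_mul, Valuation.map_mul, Valuation.map_mul, Valuation.map_pow, hs, hvu, hvd,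
      one_pow, mul_one, mul_one, mul_div_assoc, div_self hv20, mul_one]
  -- `|ι β|_w = |β|_v^e = (|ϖ_v|_v^m)^e = |ι ϖ_v|_w^m`
  have hβ0 : (β : v.adicCompletion ↥(maximalRealSubfield L)) ≠ 0 := β.ne_zero
  have hιβ : Valued.v (toPlace v w (β : v.adicCompletion ↥(maximalRealSubfield L))) =
      Valued.v (β : v.adicCompletion ↥(maximalRealSubfield L)) ^ v.asIdeal.ramificationIdx' w.1.asIdeal := valued_toPlace v w _
  have hβ1 : Valued.v (β : v.adicCompletion ↥(maximalRealSubfield L)) ≤ 1 := by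
    have hle : Valued.v (β : v.adicCompletion ↥(maximalRealSubfield L)) ^ v.asIdeal.ramificationIdx' w.1.asIdeal ≤ 1 := by
      rw [← hιβ, ← hχβ]; exact hχ1
    exact (pow_le_one_iff_of_nonneg zero_le (Ideal.IsDedekindDomain.ramificationIdx'_ne_zero_of_liesOver w.1.asIdeal v.ne_bot)).1 hle
  have hm := valued_eq_valued_uniformizer_pow_toNat L v hβ0 hβ1
  generalize (-WithZero.log (Valued.v (β : v.adicCompletion ↥(maximalRealSubfield L)))).toNat = m at hm ⊢
  rw [hχβ, hιβ, hm, Valuation.map_pow, Valuation.map_pow, valued_toPlace, ← pow_mul, ← pow_mul, mul_comm]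

end Depth

/-! ## §4 THE SEQUEL AT ANY PLACE: `Δ‴_v = (β, θ)_v · q_v^{−m} · κ_v` on matched deep pairs, its germ form, and the scalar pulled out of the `Δ_v`-weighted sum -/

section Pairs

variable (μ : HeckeCharacter L)
  (hμω : ∀ x : ideleGroup ↥(maximalRealSubfield L), μ (AdeleRing.ideleBaseChange ↥(maximalRealSubfield L) L x) = quadraticHeckeCharCM L x)

include hw hμω in
/-- **`Δ‴_v(γ_H, γ′) = (β(γ_H), θ)_v · q_v^{−m} · κ_v(γ_H, γ′)` ON MATCHED PAIRS, FOR EVERY DEEP `γ_H`, AT EVERY NON-SPLIT PLACE** (★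
`exists_forall_finExplicitDelta_eq_hilbertSymbol_mul_of_deep` with `h2` DELETED): ★ `finExplicitDelta_of_isLocalNormPair` (`Δ‴ = τ·D·κ`), the head §2 (`τ = (β, θ)_v`) and ★
`finWeylRatio_eq_inv_pow_of_smul_eq` (`D = q_v^{−m}` at any non-split place). [cite: Rogawski1990, §4.9 p. 55; Prop. 8.1.3 p. 116] [cite: LabesseLanglands1979, §2] -/
theorem exists_forall_finExplicitDelta_eq_hilbertSymbol_mul_of_deep_anyPlace (H' : Matrix (Fin 3) (Fin 3) L) :
    ∃ M₀ : ℕ, 1 ≤ M₀ ∧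
      ∀ (γH : (cmDatum L 2 (Matrix.of fun i j : Fin 2 => if i.val + j.val + 1 = 2 then (1 : L) else 0)).Local v ×
          (cmDatum L 1 (Matrix.of fun i j : Fin 1 => if i.val + j.val + 1 = 1 then (1 : L) else 0)).Local v) (m : ℕ)
        (γ' : (cmDatum L 3 H').Local v),
        Valued.v (((finCharpolyTwo L v γH).eval (finGammaTwo L v γH)) w) =
          Valued.v ((toPlace v w (HeckeCharacter.uniformizer ↥(maximalRealSubfield L) v : v.adicCompletion ↥(maximalRealSubfield L))) ^ m) →
        Valued.v (finGammaTwo L v γH w - 1) ≤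
          Valued.v ((toPlace v w (HeckeCharacter.uniformizer ↥(maximalRealSubfield L) v : v.adicCompletion ↥(maximalRealSubfield L))) ^ M₀) →
        Valued.v (((γH.1.val.val : Matrix (Fin 2) (Fin 2) (LocalRing L v)).map
            (Pi.evalRingHom (fun w' : PlacesOver L v => w'.1.adicCompletion L) w)).det - 1) ≤
          Valued.v ((toPlace v w (HeckeCharacter.uniformizer ↥(maximalRealSubfield L) v : v.adicCompletion ↥(maximalRealSubfield L))) ^ M₀) →
        ∀ β : (v.adicCompletion ↥(maximalRealSubfield L))ˣ,
          toPlace v w (β : v.adicCompletion ↥(maximalRealSubfield L)) =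
            -(((finCharpolyTwo L v γH).eval (finGammaTwo L v γH)) w *
                (finGammaTwo L v γH w ^ 2 +
                  ((γH.1.val.val : Matrix (Fin 2) (Fin 2) (LocalRing L v)).map (Pi.evalRingHom (fun w' : PlacesOver L v => w'.1.adicCompletion L) w)).det)) /
              (2 * finGammaTwo L v γH w ^ 2 *
                ((γH.1.val.val : Matrix (Fin 2) (Fin 2) (LocalRing L v)).map (Pi.evalRingHom (fun w' : PlacesOver L v => w'.1.adicCompletion L) w)).det) →
        IsLocalNormPair L H' v γH γ' →
        finExplicitDelta L v H' γH μ γ' =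
          (hilbertSymbol (v.adicCompletion ↥(maximalRealSubfield L)) (β : v.adicCompletion ↥(maximalRealSubfield L))
              (algebraMap ↥(maximalRealSubfield L) _ ((cmQuadraticGenerator L : 𝓞 ↥(maximalRealSubfield L)) : ↥(maximalRealSubfield L))) : ℂ) *
            (((Nat.card (𝓞 ↥(maximalRealSubfield L) ⧸ v.asIdeal) : ℂ) ^ m))⁻¹ * ((finKappaAt L v H' γH γ' : ℤ) : ℂ) := by
  classical
  obtain ⟨M₀, hM₁, h⟩ := exists_forall_finTau_eq_hilbertSymbol_of_deep_anyPlace L v w hw μ hμω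
  refine ⟨M₀, hM₁, fun γH m γ' hχ hud hdd β hβ hpair => ?_⟩
  have hϖ0 : (toPlace v w (HeckeCharacter.uniformizer ↥(maximalRealSubfield L) v : v.adicCompletion ↥(maximalRealSubfield L))) ≠ 0 :=
    toPlace_heckeUniformizer_ne_zero L v w
  have hχ0 : ((finCharpolyTwo L v γH).eval (finGammaTwo L v γH)) w ≠ 0 := fun h0 => by
    rw [h0, map_zero] at hχ
    exact (Valuation.ne_zero_iff _).2 (pow_ne_zero m hϖ0) hχ.symm
  rw [finExplicitDelta_of_isLocalNormPair L v H' γH μ hpair, h γH hχ0 hud hdd β hβ, finWeylRatio_eq_inv_pow_of_smul_eq L v w hw γH hχ]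
  push_cast
  ring

include hw hμω in
/-- **Germ form at `1 ∈ H_v`, at any non-split place**: `∃ V ∈ 𝓝 1, ∀ γ_H ∈ V`, on matched pairs `Δ‴_v(γ_H, γ′) = (β(γ_H), θ)_v · q_v^{−m} · κ_v(γ_H, γ′)`
(`|χ_g(u)_w|_w = |ι_w ϖ_v|_w^m`) — ★ `exists_nhds_one_forall_finExplicitDelta_eq_hilbertSymbol_mul` with `h2` DELETED. [cite: Rogawski1990, §4.9 p. 55; Prop. 8.1.3 p. 116]
[cite: LabesseLanglands1979, §2] -/
theorem exists_nhds_one_forall_finExplicitDelta_eq_hilbertSymbol_mul_anyPlace (H' : Matrix (Fin 3) (Fin 3) L) :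
    ∃ V ∈ 𝓝 (1 : (cmDatum L 2 (Matrix.of fun i j : Fin 2 => if i.val + j.val + 1 = 2 then (1 : L) else 0)).Local v ×
        (cmDatum L 1 (Matrix.of fun i j : Fin 1 => if i.val + j.val + 1 = 1 then (1 : L) else 0)).Local v),
      ∀ γH ∈ V, ∀ (m : ℕ) (γ' : (cmDatum L 3 H').Local v),
        Valued.v (((finCharpolyTwo L v γH).eval (finGammaTwo L v γH)) w) =
          Valued.v ((toPlace v w (HeckeCharacter.uniformizer ↥(maximalRealSubfield L) v : v.adicCompletion ↥(maximalRealSubfield L))) ^ m) →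
        ∀ β : (v.adicCompletion ↥(maximalRealSubfield L))ˣ,
          toPlace v w (β : v.adicCompletion ↥(maximalRealSubfield L)) =
            -(((finCharpolyTwo L v γH).eval (finGammaTwo L v γH)) w *
                (finGammaTwo L v γH w ^ 2 +
                  ((γH.1.val.val : Matrix (Fin 2) (Fin 2) (LocalRing L v)).map (Pi.evalRingHom (fun w' : PlacesOver L v => w'.1.adicCompletion L) w)).det)) /
              (2 * finGammaTwo L v γH w ^ 2 *
                ((γH.1.val.val : Matrix (Fin 2) (Fin 2) (LocalRing L v)).map (Pi.evalRingHom (fun w' : PlacesOver L v => w'.1.adicCompletion L) w)).det) →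
        IsLocalNormPair L H' v γH γ' →
        finExplicitDelta L v H' γH μ γ' =
          (hilbertSymbol (v.adicCompletion ↥(maximalRealSubfield L)) (β : v.adicCompletion ↥(maximalRealSubfield L))
              (algebraMap ↥(maximalRealSubfield L) _ ((cmQuadraticGenerator L : 𝓞 ↥(maximalRealSubfield L)) : ↥(maximalRealSubfield L))) : ℂ) *
            (((Nat.card (𝓞 ↥(maximalRealSubfield L) ⧸ v.asIdeal) : ℂ) ^ m))⁻¹ * ((finKappaAt L v H' γH γ' : ℤ) : ℂ) := by
  obtain ⟨M₀, -, h⟩ := exists_forall_finExplicitDelta_eq_hilbertSymbol_mul_of_deep_anyPlace L v w hw μ hμω H'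
  have hϖ0 : (toPlace v w (HeckeCharacter.uniformizer ↥(maximalRealSubfield L) v : v.adicCompletion ↥(maximalRealSubfield L))) ^ M₀ ≠ 0 :=
    pow_ne_zero _ (toPlace_heckeUniformizer_ne_zero L v w)
  refine (Filter.Eventually.exists_mem ?_)
  filter_upwards [eventually_nhds_one_valued_sub_one_le L v w hϖ0] with γH hγ m γ' hχ β hβ hpair
  exact h γH m γ' hχ hγ.1 hγ.2 β hβ hpair

end Pairs

section ScalarPull

variable (μ : HeckeCharacter L)
  (hμω : ∀ x : ideleGroup ↥(maximalRealSubfield L), μ (AdeleRing.ideleBaseChange ↥(maximalRealSubfield L) L x) = quadraticHeckeCharCM L x)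
  (H' : Matrix (Fin 3) (Fin 3) L)
  (hl : ∀ (v : HeightOneSpectrum (𝓞 ↥(maximalRealSubfield L)))
    (a : (cmDatum L 2 (Matrix.of fun i j : Fin 2 => if i.val + j.val + 1 = 2 then (1 : L) else 0)).Local v ×
      (cmDatum L 1 (Matrix.of fun i j : Fin 1 => if i.val + j.val + 1 = 1 then (1 : L) else 0)).Local v)
    (b : (cmDatum L 3 H').Local v)
    (x : (cmDatum L 2 (Matrix.of fun i j : Fin 2 => if i.val + j.val + 1 = 2 then (1 : L) else 0)).Local v ×
      (cmDatum L 1 (Matrix.of fun i j : Fin 1 => if i.val + j.val + 1 = 1 then (1 : L) else 0)).Local v),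
    finExplicitDelta L v H' (x * a * x⁻¹) μ b = finExplicitDelta L v H' a μ b)
  (hr : ∀ (v : HeightOneSpectrum (𝓞 ↥(maximalRealSubfield L)))
    (a : (cmDatum L 2 (Matrix.of fun i j : Fin 2 => if i.val + j.val + 1 = 2 then (1 : L) else 0)).Local v ×
      (cmDatum L 1 (Matrix.of fun i j : Fin 1 => if i.val + j.val + 1 = 1 then (1 : L) else 0)).Local v)
    (b y : (cmDatum L 3 H').Local v),
    finExplicitDelta L v H' a μ (y * b * y⁻¹) = finExplicitDelta L v H' a μ b)

open scoped Classical in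
include hw hμω in
/-- **THE SCALAR PULLED OUT, AT ANY NON-SPLIT PLACE (binder currency)** — ★ `exists_nhds_one_forall_finsum_Δ_mul_eq_hilbertSymbol_mul` with `h2` DELETED: `V ∈ 𝓝 (1 : H_v)`
such that for every `γ_H ∈ V`, every `m` with `|χ_g(u)_w|_w = |ι_w ϖ_v|_w^m`, every `β ∈ L⁺_vˣ` mapping to the symmetrised discriminant and every weight `O`,
`Σᶠ_c Δ_v(γ_H, c̃)·O(c) = (β, θ)_v · q_v^{−m} · Σᶠ_c [ι_v(γ_H) ↔ c̃]·κ_v(γ_H, c̃)·O(c)`. [cite: Rogawski1990, §4.9 p. 55; §4.3 p. 43; Prop. 8.1.3 p. 116]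
[cite: LabesseLanglands1979, §2] -/
theorem exists_nhds_one_forall_finsum_Δ_mul_eq_hilbertSymbol_mul_anyPlace :
    ∃ V ∈ 𝓝 (1 : (cmDatum L 2 (Matrix.of fun i j : Fin 2 => if i.val + j.val + 1 = 2 then (1 : L) else 0)).Local v ×
        (cmDatum L 1 (Matrix.of fun i j : Fin 1 => if i.val + j.val + 1 = 1 then (1 : L) else 0)).Local v),
      ∀ γH ∈ V, ∀ (m : ℕ) (O : ConjClasses ((cmDatum L 3 H').Local v) → ℂ),
        Valued.v (((finCharpolyTwo L v γH).eval (finGammaTwo L v γH)) w) =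
          Valued.v ((toPlace v w (HeckeCharacter.uniformizer ↥(maximalRealSubfield L) v : v.adicCompletion ↥(maximalRealSubfield L))) ^ m) →
        ∀ β : (v.adicCompletion ↥(maximalRealSubfield L))ˣ,
          toPlace v w (β : v.adicCompletion ↥(maximalRealSubfield L)) =
            -(((finCharpolyTwo L v γH).eval (finGammaTwo L v γH)) w *
                (finGammaTwo L v γH w ^ 2 +
                  ((γH.1.val.val : Matrix (Fin 2) (Fin 2) (LocalRing L v)).map (Pi.evalRingHom (fun w' : PlacesOver L v => w'.1.adicCompletion L) w)).det)) /
              (2 * finGammaTwo L v γH w ^ 2 *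
                ((γH.1.val.val : Matrix (Fin 2) (Fin 2) (LocalRing L v)).map (Pi.evalRingHom (fun w' : PlacesOver L v => w'.1.adicCompletion L) w)).det) →
        ∑ᶠ c : ConjClasses ((cmDatum L 3 H').Local v), (finExplicitCollection L H' μ hl hr v).Δ γH (Quotient.out c) * O c =
          (hilbertSymbol (v.adicCompletion ↥(maximalRealSubfield L)) (β : v.adicCompletion ↥(maximalRealSubfield L))
              (algebraMap ↥(maximalRealSubfield L) _ ((cmQuadraticGenerator L : 𝓞 ↥(maximalRealSubfield L)) : ↥(maximalRealSubfield L))) : ℂ) *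
            (((Nat.card (𝓞 ↥(maximalRealSubfield L) ⧸ v.asIdeal) : ℂ) ^ m))⁻¹ *
            ∑ᶠ c : ConjClasses ((cmDatum L 3 H').Local v),
              (if IsLocalNormPair L H' v γH (Quotient.out c) then ((finKappaAt L v H' γH (Quotient.out c) : ℤ) : ℂ) else 0) * O c := by
  obtain ⟨V, hV, h⟩ := exists_nhds_one_forall_finExplicitDelta_eq_hilbertSymbol_mul_anyPlace L v w hw μ hμω H'
  refine ⟨V, hV, fun γH hγ m O hχ β hβ => ?_⟩
  rw [mul_finsum]
  refine finsum_congr fun c => ?_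
  rw [finExplicitCollection_Δ]
  by_cases hp : IsLocalNormPair L H' v γH (Quotient.out c)
  · rw [h γH hγ m (Quotient.out c) hχ β hβ hp, if_pos hp]
    ring
  · rw [finExplicitDelta_of_not_isLocalNormPair L v H' γH μ hp, if_neg hp, zero_mul, mul_zero]

open scoped Classical in
include hw hμω in
/-- **THE SCALAR PULLED OUT, AT ANY NON-SPLIT PLACE (`β`-function currency)** — ★ `exists_nhds_one_forall_finsum_Δ_mul_eq_hilbertSymbol_mul_toNat` with `h2` DELETED:
`V ∈ 𝓝 (1 : H_v)` with, for every `γ_H ∈ V` that is `G`-regular at `w` (`χ_g(u)_w ≠ 0`), every `β ∈ L⁺_vˣ` mapping to the symmetrised discriminant and every weight `O`,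
`Σᶠ_c Δ_v(γ_H, c̃)·O(c) = (β, θ)_v · q_v^{−m(β)} · Σᶠ_c [ι_v(γ_H) ↔ c̃]·κ_v(γ_H, c̃)·O(c)` with `m(β) := (−log|β|_v).toNat = ord_v β` (§3: the depth token exists for every
`|2|`-deep `G`-regular `γ_H`). [cite: Rogawski1990, §4.9 p. 55; §4.3 p. 43; Prop. 8.1.3 p. 116] [cite: LabesseLanglands1979, §2] -/
theorem exists_nhds_one_forall_finsum_Δ_mul_eq_hilbertSymbol_mul_toNat_anyPlace :
    ∃ V ∈ 𝓝 (1 : (cmDatum L 2 (Matrix.of fun i j : Fin 2 => if i.val + j.val + 1 = 2 then (1 : L) else 0)).Local v ×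
        (cmDatum L 1 (Matrix.of fun i j : Fin 1 => if i.val + j.val + 1 = 1 then (1 : L) else 0)).Local v),
      ∀ γH ∈ V, ∀ O : ConjClasses ((cmDatum L 3 H').Local v) → ℂ, ((finCharpolyTwo L v γH).eval (finGammaTwo L v γH)) w ≠ 0 →
        ∀ β : (v.adicCompletion ↥(maximalRealSubfield L))ˣ,
          toPlace v w (β : v.adicCompletion ↥(maximalRealSubfield L)) =
            -(((finCharpolyTwo L v γH).eval (finGammaTwo L v γH)) w *
                (finGammaTwo L v γH w ^ 2 +
                  ((γH.1.val.val : Matrix (Fin 2) (Fin 2) (LocalRing L v)).map (Pi.evalRingHom (fun w' : PlacesOver L v => w'.1.adicCompletion L) w)).det)) /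
              (2 * finGammaTwo L v γH w ^ 2 *
                ((γH.1.val.val : Matrix (Fin 2) (Fin 2) (LocalRing L v)).map (Pi.evalRingHom (fun w' : PlacesOver L v => w'.1.adicCompletion L) w)).det) →
        ∑ᶠ c : ConjClasses ((cmDatum L 3 H').Local v), (finExplicitCollection L H' μ hl hr v).Δ γH (Quotient.out c) * O c =
          (hilbertSymbol (v.adicCompletion ↥(maximalRealSubfield L)) (β : v.adicCompletion ↥(maximalRealSubfield L))
              (algebraMap ↥(maximalRealSubfield L) _ ((cmQuadraticGenerator L : 𝓞 ↥(maximalRealSubfield L)) : ↥(maximalRealSubfield L))) : ℂ) *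
            (((Nat.card (𝓞 ↥(maximalRealSubfield L) ⧸ v.asIdeal) : ℂ) ^
              (-WithZero.log (Valued.v (β : v.adicCompletion ↥(maximalRealSubfield L)))).toNat))⁻¹ *
            ∑ᶠ c : ConjClasses ((cmDatum L 3 H').Local v),
              (if IsLocalNormPair L H' v γH (Quotient.out c) then ((finKappaAt L v H' γH (Quotient.out c) : ℤ) : ℂ) else 0) * O c := by
  obtain ⟨V, hV, h⟩ := exists_nhds_one_forall_finsum_Δ_mul_eq_hilbertSymbol_mul_anyPlace L v w hw μ hμω H' hl hr
  obtain ⟨U, hU, hU1⟩ := (eventually_nhds_one_valued_eval_lt_one L v w).exists_mem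
  obtain ⟨a, ha⟩ := exists_valued_two_eq_valued_toPlace_heckeUniformizer_pow L v w
  have hϖ0 : (toPlace v w (HeckeCharacter.uniformizer ↥(maximalRealSubfield L) v : v.adicCompletion ↥(maximalRealSubfield L))) ^ (1 + a) ≠ 0 :=
    pow_ne_zero _ (toPlace_heckeUniformizer_ne_zero L v w)
  have h1a : Valued.v ((toPlace v w (HeckeCharacter.uniformizer ↥(maximalRealSubfield L) v : v.adicCompletion ↥(maximalRealSubfield L))) ^ (1 + a)) =
      Valued.v (2 : w.1.adicCompletion L) *
        Valued.v ((toPlace v w (HeckeCharacter.uniformizer ↥(maximalRealSubfield L) v : v.adicCompletion ↥(maximalRealSubfield L))) ^ 1) := by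
    rw [pow_add, Valuation.map_mul, ← ha, mul_comm]
  obtain ⟨W, hW, hW1⟩ := (eventually_nhds_one_valued_sub_one_le L v w hϖ0).exists_mem
  refine ⟨V ∩ (U ∩ W), Filter.inter_mem hV (Filter.inter_mem hU hW), fun γH hγ O _hχ0 β hβ => ?_⟩
  exact h γH hγ.1 _ O
    (valued_eval_eq_valued_toPlace_pow_toNat_of_toPlace_eq_of_valued_le_two_mul L v w le_rfl γH (le_trans (hW1 γH hγ.2.2).1 (le_of_eq h1a))
      (le_trans (hW1 γH hγ.2.2).2 (le_of_eq h1a)) (hU1 γH hγ.2.1).le β hβ) β hβ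

end ScalarPull

end Literature.NumberTheory.Rogawski1990

end
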